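import Summits.Ventures.PercRepro.Night2LocalRuleDefs

/-!
# PercRepro — the three-layer rule with distance-2 routing: rows, columns, the certificate (night-2, gen 8)

Continues `Night2LocalRuleDefs.lean`.  **`localShadowHall_of_distance_two`**: with `|E ∖ G| ≤ q`, the rule's rows
are exact (`sum_wRule_row`: every member receives exactly `Φ · localWeight`) and its column sum at `S` is
`1 − cap2 S + load2 S` (`sum_wRule_col`); so the local form (LI_G) holds at `G` as soon as the layer-2 load never
exceeds the residual capacity (`load2 S ≤ cap2 S` at every shadow set).  Theorem E of `proofs/NIGHT-2-local.md`
§17(k) verifies that column condition on paper at `d = q` with few coloops; this file is the matching-side half.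
-/

namespace PercRepro.Shadow

open Finset PerFlat ThmH

variable {α : Type*} [DecidableEq α] {M : Matroid α} [M.Finite]

/-! ## Columns -/

open scoped Classical in
/-- The layer-0 column sum at `S` is `k1 S · Φ/(1+d)`. -/
theorem sum_w0_col (q : ℕ) (G S : Finset α) :
    ∑ B ∈ membersIn M (Uq M (q + 2) q) G, w0 M q G B S =
      (k1 M q G S : ℚ) * (phiQ q / (1 + ((gr M \ G).card : ℚ))) := by
  unfold w0
  rw [← Finset.sum_filter, Finset.sum_const, nsmul_eq_mul]
  congr 2
  unfold k1 coverPreimages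
  rw [Finset.filter_filter]
  congr 1
  ext B
  simp only [Finset.mem_filter]
  tauto

open scoped Classical in
/-- The layer-1 column sum at `S` is `fS S · L1 S`. -/
theorem sum_w1_col (q : ℕ) (G S : Finset α) :
    ∑ B ∈ membersIn M (Uq M (q + 2) q) G, w1 M q G B S = fS M q G S * L1 M q G S := by
  unfold w1
  rw [← Finset.sum_filter]
  unfold L1 coverPreimages
  rw [Finset.filter_filter, Finset.mul_sum]
  have hset : (membersIn M (Uq M (q + 2) q) G).filter (fun B => B ∉ lay0 M q G ∧ S ∈ coverSets M B G) =
      (membersIn M (Uq M (q + 2) q) G).filter (fun B => S ∈ coverSets M B G ∧ B ∉ lay0 M q G) := by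
    ext B
    simp only [Finset.mem_filter]
    tauto
  rw [hset]
  apply Finset.sum_congr rfl
  intro B _
  ring

open scoped Classical in
/-- The column sum of the rule at `S` is `1 − cap2 S + load2 S`. -/
theorem sum_wRule_col (q : ℕ) (G S : Finset α) :
    ∑ B ∈ membersIn M (Uq M (q + 2) q) G, wRule M q G B S = 1 - cap2 M q G S + load2 M q G S := by
  unfold wRule
  rw [Finset.sum_add_distrib, Finset.sum_add_distrib, sum_w0_col, sum_w1_col]
  unfold load2 cap2 capS
  ring


/-! ## Rows -/

/-- The pairs of `Z` through `z`: `|Z| − 1` of them. -/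
theorem card_pairs_through {Z : Finset α} {z : α} (hz : z ∈ Z) :
    ((Finset.powersetCard 2 Z).filter (fun P => z ∈ P)).card = Z.card - 1 := by
  have himg : (Finset.powersetCard 2 Z).filter (fun P => z ∈ P) =
      (Z.erase z).image (fun z' => insert z ({z'} : Finset α)) := by
    ext P
    rw [Finset.mem_filter, Finset.mem_powersetCard, Finset.mem_image]
    constructor
    · rintro ⟨⟨hPZ, hP2⟩, hzP⟩
      obtain ⟨x, y, hxy, rfl⟩ := Finset.card_eq_two.1 hP2
      rw [Finset.mem_insert, Finset.mem_singleton] at hzP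
      rcases hzP with rfl | rfl
      · refine ⟨y, Finset.mem_erase.2 ⟨fun h => hxy h.symm, hPZ (by simp)⟩, rfl⟩
      · refine ⟨x, Finset.mem_erase.2 ⟨hxy, hPZ (by simp)⟩, ?_⟩
        rw [Finset.pair_comm]
    · rintro ⟨z', hz', rfl⟩
      rw [Finset.mem_erase] at hz'
      refine ⟨⟨?_, ?_⟩, Finset.mem_insert_self _ _⟩
      · intro e he
        rw [Finset.mem_insert, Finset.mem_singleton] at he
        rcases he with rfl | rfl
        · exact hz
        · exact hz'.2
      · rw [Finset.card_insert_of_notMem (by rw [Finset.mem_singleton]; exact fun h => hz'.1 h.symm),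
          Finset.card_singleton]
  rw [himg, Finset.card_image_of_injOn, Finset.card_erase_of_mem hz]
  intro a ha b hb hab
  rw [Finset.mem_coe, Finset.mem_erase] at ha hb
  have h : insert z ({a} : Finset α) = insert z ({b} : Finset α) := hab
  have ha' : a ∈ insert z ({b} : Finset α) := by rw [← h]; simp
  rw [Finset.mem_insert, Finset.mem_singleton] at ha'
  rcases ha' with h' | h'
  · exact absurd h' ha.1
  · exact h'

/-- Double counting over the pairs of `Z`: `Σ_{P} Σ_{z ∈ P} g z = (|Z| − 1) Σ_{z ∈ Z} g z`. -/
theorem sum_pairs_eq (Z : Finset α) (g : α → ℚ) :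
    ∑ P ∈ Finset.powersetCard 2 Z, ∑ z ∈ P, g z = ((Z.card : ℚ) - 1) * ∑ z ∈ Z, g z := by
  rw [Finset.sum_comm' (t' := Z) (s' := fun z => (Finset.powersetCard 2 Z).filter (fun P => z ∈ P))]
  · rw [Finset.mul_sum]
    apply Finset.sum_congr rfl
    intro z hz
    rw [Finset.sum_const, nsmul_eq_mul, card_pairs_through hz]
    have h1 : 1 ≤ Z.card := Finset.card_pos.2 ⟨z, hz⟩
    rw [Nat.cast_sub h1, Nat.cast_one]
  · intro P z
    rw [Finset.mem_filter]
    constructor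
    · rintro ⟨hP, hzP⟩
      exact ⟨⟨hP, hzP⟩, (Finset.mem_powersetCard.1 hP).1 hzP⟩
    · rintro ⟨⟨hP, hzP⟩, -⟩
      exact ⟨hP, hzP⟩

open scoped Classical in
/-- Inserting distinct elements outside `B` gives distinct sets. -/
theorem insert_injOn {B Z : Finset α} (hZ : Disjoint Z B) :
    Set.InjOn (fun z => insert z B) (Z : Set α) := by
  intro a ha b hb hab
  rw [Finset.mem_coe] at ha hb
  have haB : a ∉ B := Finset.disjoint_left.1 hZ ha
  have h : insert a B = insert b B := hab
  have ha' : a ∈ insert b B := by rw [← h]; exact Finset.mem_insert_self _ _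
  rw [Finset.mem_insert] at ha'
  rcases ha' with h' | h'
  · exact h'
  · exact absurd h' haB

open scoped Classical in
/-- The row sum of layer 1 for a member `B ∉ lay0`. -/
theorem sum_w1_row {q : ℕ} {G : Finset α} (hG : G ∈ flatsQ M (q + 1)) {B : Finset α}
    (hB : B ∈ membersIn M (Uq M (q + 2) q) G) (hB0 : B ∉ lay0 M q G) :
    ∑ S ∈ shadowAt M (q + 2) q (Uq M (q + 2) q) G, w1 M q G B S =
      ∑ z ∈ G \ clF M B, req M q B * fS M q G (insert z B) := by
  have hBU : B ∈ Uq M (q + 2) q := (mem_membersIn.1 hB).1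
  have hsub : coverSets M B G ⊆ shadowAt M (q + 2) q (Uq M (q + 2) q) G :=
    coverSets_subset_shadowAt (Finset.Subset.refl _) hG hB
  unfold w1
  have hcond : ∀ S, (B ∉ lay0 M q G ∧ S ∈ coverSets M B G) ↔ S ∈ coverSets M B G :=
    fun S => ⟨fun h => h.2, fun h => ⟨hB0, h⟩⟩
  simp_rw [hcond]
  rw [← Finset.sum_filter, Finset.filter_mem_eq_inter, Finset.inter_eq_right.2 hsub]
  unfold coverSets
  rw [Finset.sum_image (insert_injOn ?_)]
  rw [Finset.disjoint_left]
  intro z hz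
  exact notMem_of_notMem_clF hBU (Finset.mem_sdiff.1 hz).2

open scoped Classical in
/-- The row sum of layer 0 for a layer-0 member is its whole demand. -/
theorem sum_w0_row_lay0 {q : ℕ} {G : Finset α} (hG : G ∈ flatsQ M (q + 1)) {B : Finset α}
    (hB0 : B ∈ lay0 M q G) :
    ∑ S ∈ shadowAt M (q + 2) q (Uq M (q + 2) q) G, w0 M q G B S =
      phiQ q / (1 + ((gr M \ G).card : ℚ)) := by
  have hB : B ∈ membersIn M (Uq M (q + 2) q) G := (mem_lay0.1 hB0).1
  have hBU : B ∈ Uq M (q + 2) q := (mem_membersIn.1 hB).1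
  have hsub : coverSets M B G ⊆ shadowAt M (q + 2) q (Uq M (q + 2) q) G :=
    coverSets_subset_shadowAt (Finset.Subset.refl _) hG hB
  unfold w0
  have hcond : ∀ S, (B ∈ lay0 M q G ∧ S ∈ coverSets M B G) ↔ S ∈ coverSets M B G :=
    fun S => ⟨fun h => h.2, fun h => ⟨hB0, h⟩⟩
  simp_rw [hcond]
  rw [← Finset.sum_filter, Finset.filter_mem_eq_inter, Finset.inter_eq_right.2 hsub, Finset.sum_const,
    card_coverSets hBU, (mem_lay0.1 hB0).2.1, one_smul]


open scoped Classical in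
/-- The row sum of layer 2 for a member `B ∉ lay0` with `|G ∖ cl B| ≥ 2` is its total loss. -/
theorem sum_w2_row {q : ℕ} {G : Finset α} (hG : G ∈ flatsQ M (q + 1)) {B : Finset α}
    (hB : B ∈ membersIn M (Uq M (q + 2) q) G) (hB0 : B ∉ lay0 M q G) (hm : 2 ≤ (G \ clF M B).card) :
    ∑ S ∈ shadowAt M (q + 2) q (Uq M (q + 2) q) G, w2 M q G B S =
      ∑ z ∈ G \ clF M B, loss M q G B z := by
  have hBU : B ∈ Uq M (q + 2) q := (mem_membersIn.1 hB).1
  have hdisj : Disjoint (G \ clF M B) B := by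
    rw [Finset.disjoint_left]
    intro z hz
    exact notMem_of_notMem_clF hBU (Finset.mem_sdiff.1 hz).2
  unfold w2
  rw [← Finset.sum_filter]
  have hset : (shadowAt M (q + 2) q (Uq M (q + 2) q) G).filter
      (fun S => B ∉ lay0 M q G ∧ B ⊆ S ∧ S \ B ⊆ G \ clF M B ∧ (S \ B).card = 2) =
      (Finset.powersetCard 2 (G \ clF M B)).image (fun P => B ∪ P) := by
    ext S
    rw [Finset.mem_filter, Finset.mem_image]
    constructor
    · rintro ⟨hS, -, hBS, hsub, hcard⟩
      refine ⟨S \ B, Finset.mem_powersetCard.2 ⟨hsub, hcard⟩, ?_⟩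
      rw [Finset.union_sdiff_self_eq_union, Finset.union_eq_right.2 hBS]
    · rintro ⟨P, hP, rfl⟩
      rw [Finset.mem_powersetCard] at hP
      have hPB : Disjoint P B := Finset.disjoint_of_subset_left hP.1 hdisj
      have hPne : P.Nonempty := by
        rw [← Finset.card_pos, hP.2]; exact two_pos
      have hPsd : (B ∪ P) \ B = P := by
        rw [Finset.union_sdiff_left, Finset.sdiff_eq_self_of_disjoint hPB]
      refine ⟨union_mem_shadowAt (Finset.Subset.refl _) hG hB hP.1 hPne, hB0, Finset.subset_union_left, ?_, ?_⟩
      · rw [hPsd]; exact hP.1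
      · rw [hPsd]; exact hP.2
  rw [hset]
  have hinj : Set.InjOn (fun P => B ∪ P) ((Finset.powersetCard 2 (G \ clF M B) : Finset (Finset α)) :
      Set (Finset α)) := by
    intro P hP P' hP' hPP'
    rw [Finset.mem_coe, Finset.mem_powersetCard] at hP hP'
    have h1 : (B ∪ P) \ B = P :=
      by rw [Finset.union_sdiff_left, Finset.sdiff_eq_self_of_disjoint (Finset.disjoint_of_subset_left hP.1 hdisj)]
    have h2 : (B ∪ P') \ B = P' :=
      by rw [Finset.union_sdiff_left, Finset.sdiff_eq_self_of_disjoint (Finset.disjoint_of_subset_left hP'.1 hdisj)]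
    have h3 : B ∪ P = B ∪ P' := hPP'
    rw [← h1, ← h2, h3]
  rw [Finset.sum_image hinj]
  have hden : ((G \ clF M B).card : ℚ) - 1 ≠ 0 := by
    have : (2 : ℚ) ≤ ((G \ clF M B).card : ℚ) := by exact_mod_cast hm
    intro h; linarith
  have hterm : ∀ P ∈ Finset.powersetCard 2 (G \ clF M B),
      (∑ z ∈ (B ∪ P) \ B, loss M q G B z) / (((G \ clF M B).card : ℚ) - 1) =
      (∑ z ∈ P, loss M q G B z) / (((G \ clF M B).card : ℚ) - 1) := by
    intro P hP
    rw [Finset.mem_powersetCard] at hP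
    rw [Finset.union_sdiff_left, Finset.sdiff_eq_self_of_disjoint (Finset.disjoint_of_subset_left hP.1 hdisj)]
  rw [Finset.sum_congr rfl hterm, ← Finset.sum_div, sum_pairs_eq, mul_div_assoc, mul_div_cancel₀ _ hden]

open scoped Classical in
/-- Members outside layer 0 have at least two covering sets when `|E ∖ G| ≤ q`. -/
theorem two_le_card_sdiff_of_not_lay0 {q : ℕ} {G : Finset α} (hG : G ∈ flatsQ M (q + 1))
    (hd : (gr M \ G).card ≤ q) {B : Finset α} (hB : B ∈ membersIn M (Uq M (q + 2) q) G)
    (hB0 : B ∉ lay0 M q G) : 2 ≤ (G \ clF M B).card := by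
  have hBU : B ∈ Uq M (q + 2) q := (mem_membersIn.1 hB).1
  have h1 := one_le_card_sdiff_clF hG hBU
  by_contra hlt
  have hm : (G \ clF M B).card = 1 := by omega
  exact hB0 (mem_lay0.2 ⟨hB, hm, by omega⟩)

open scoped Classical in
/-- **Rows are exact**: every member receives exactly its local demand. -/
theorem sum_wRule_row {q : ℕ} {G : Finset α} (hG : G ∈ flatsQ M (q + 1)) (hd : (gr M \ G).card ≤ q)
    {B : Finset α} (hB : B ∈ membersIn M (Uq M (q + 2) q) G) :
    ∑ S ∈ shadowAt M (q + 2) q (Uq M (q + 2) q) G, wRule M q G B S =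
      phiQ q * localWeight M B G := by
  have hBU : B ∈ Uq M (q + 2) q := (mem_membersIn.1 hB).1
  have hBG : clF M B ⊆ G := (mem_membersIn.1 hB).2
  have hc : ((gr M \ clF M B).card : ℚ) = ((G \ clF M B).card : ℚ) + ((gr M \ G).card : ℚ) := by
    rw [card_compl_clF_add hG hBG]; push_cast; ring
  unfold wRule
  rw [Finset.sum_add_distrib, Finset.sum_add_distrib]
  by_cases hB0 : B ∈ lay0 M q G
  · rw [sum_w0_row_lay0 hG hB0]
    have hz1 : ∑ S ∈ shadowAt M (q + 2) q (Uq M (q + 2) q) G, w1 M q G B S = 0 := by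
      apply Finset.sum_eq_zero
      intro S _
      unfold w1
      rw [if_neg]
      intro h; exact h.1 hB0
    have hz2 : ∑ S ∈ shadowAt M (q + 2) q (Uq M (q + 2) q) G, w2 M q G B S = 0 := by
      apply Finset.sum_eq_zero
      intro S _
      unfold w2
      rw [if_neg]
      intro h; exact h.1 hB0
    rw [hz1, hz2, add_zero, add_zero]
    unfold localWeight
    rw [(mem_lay0.1 hB0).2.1, hc, (mem_lay0.1 hB0).2.1]
    push_cast
    ring
  · have hm := two_le_card_sdiff_of_not_lay0 hG hd hB hB0
    have hz0 : ∑ S ∈ shadowAt M (q + 2) q (Uq M (q + 2) q) G, w0 M q G B S = 0 := by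
      apply Finset.sum_eq_zero
      intro S _
      unfold w0
      rw [if_neg]
      intro h; exact hB0 h.1
    rw [hz0, zero_add, sum_w1_row hG hB hB0, sum_w2_row hG hB hB0 hm, ← Finset.sum_add_distrib]
    have hterm : ∀ z ∈ G \ clF M B,
        req M q B * fS M q G (insert z B) + loss M q G B z = req M q B := by
      intro z _
      unfold loss
      ring
    rw [Finset.sum_congr rfl hterm, Finset.sum_const, nsmul_eq_mul]
    unfold req localWeight
    have hcpos : (0 : ℚ) < ((gr M \ clF M B).card : ℚ) := by
      have := two_le_card_compl_clF hBU
      exact_mod_cast (by omega : 0 < (gr M \ clF M B).card)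
    field_simp

open scoped Classical in
/-- A set with a covering preimage lies in `G`. -/
theorem subset_of_coverPreimages_nonempty {q : ℕ} {G S : Finset α}
    (h : (coverPreimages M (Uq M (q + 2) q) G S).Nonempty) : S ⊆ G := by
  obtain ⟨B, hB⟩ := h
  rw [mem_coverPreimages] at hB
  obtain ⟨z, hz, rfl⟩ := mem_coverSets.1 hB.2
  have hBU : B ∈ Uq M (q + 2) q := (mem_membersIn.1 hB.1).1
  have hBG : clF M B ⊆ G := (mem_membersIn.1 hB.1).2
  exact Finset.insert_subset (Finset.mem_sdiff.1 hz).1 ((subset_clF hBU).trans hBG)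

open scoped Classical in
/-- `capS S ≥ 0` for every `S` when `|E ∖ G| ≤ q`. -/
theorem capS_nonneg' {q : ℕ} {G : Finset α} (hG : G ∈ flatsQ M (q + 1)) (hd : (gr M \ G).card ≤ q)
    (S : Finset α) : 0 ≤ capS M q G S := by
  by_cases hS : S ⊆ G
  · exact capS_nonneg hG hd hS
  · have hk : k1 M q G S = 0 := by
      unfold k1
      rw [Finset.card_eq_zero, Finset.filter_eq_empty_iff]
      intro B hB
      exact absurd (subset_of_coverPreimages_nonempty ⟨B, hB⟩) hS
    unfold capS
    rw [hk]
    simp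


/-! ## The certificate -/

open scoped Classical in
/-- **The local form from the distance-2 rule.**  With `|E ∖ G| ≤ q`, if the layer-2 load never exceeds the
residual capacity, then (LI_G) holds at `G`. -/
theorem localShadowHall_of_distance_two {q : ℕ} {G : Finset α} (hG : G ∈ flatsQ M (q + 1))
    (hd : (gr M \ G).card ≤ q)
    (hcol : ∀ S ∈ shadowAt M (q + 2) q (Uq M (q + 2) q) G, load2 M q G S ≤ cap2 M q G S) :
    LocalShadowHall M q G := by
  apply localShadowHall_of_full_matching (wRule M q G)
  · intro B S
    unfold wRule
    exact add_nonneg (add_nonneg (w0_nonneg q G B S) (w1_nonneg (capS_nonneg' hG hd S) B))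
      (w2_nonneg (fun z _ => capS_nonneg' hG hd _))
  · exact fun B S h => subset_of_wRule_ne h
  · intro S hS
    rw [sum_wRule_col]
    have := hcol S hS
    linarith
  · intro B hB
    rw [sum_wRule_row hG hd hB]
    exact le_refl _


end PercRepro.Shadow
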